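import Literature.Probability.Percolation.AdjGoodBound
import Literature.Probability.Percolation.AdjExtR
import Literature.Probability.Percolation.AdjInitR
import Literature.Probability.Percolation.AdjSchemeArith
import Literature.Probability.Percolation.AdjFourArmClean
import Literature.Probability.Percolation.ArmSeparationOutSchemeFour
import HarnessLib

/-!
# The external half of the four-arm separation theorem for the ADJACENT arrangement, at `p`

Topic `Literature/Probability/Percolation`; family `crit-perc` / near-critical percolation on `𝕋`.
The outer multi-scale scheme of the near-critical arm-separation theorem for four arms in the
ADJACENT colour arrangement (P. Nolin, *Near-critical percolation in two dimensions*, EJP 13 (2008),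
Thm. 11 for `j = 4`, `σ = BBWW` [arXiv 0711.4948: Thm. 10], §4.4 pp. 11–13, external extremities;
"uniformly in `p`" below the characteristic length): the four arms of the cyclically adjacent
event crossing `{n ≤ |v| ≤ N}` (`adjFourArmCyc n N`) can be required to land on the sides
`0, 1` (open) and `3, 4` (closed) of `∂Λ_N` with outer free spaces (`extFourAdjR n N`) at constant
cost,

  `P_p(adjFourArmCyc n N) ≤ C · P_p(extFourAdjR n N)`  for `n ≥ n₀`, `2n ≤ N ≤ Ncap`,

at every `p` at which the frame input `hF` and the RSW inputs `hrsw` (aspect ratio `1024`) and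
`hrswL` (aspect ratio `256 · 32^K`, only for the landing) hold at `p` and `1 - p` for heights
`≤ Ncap`. Nolin's induction on the doubling ladder (`le_mul_of_separationScheme_upto`) fed with the
adjacent bricks: the surgery `adjFourArmCyc_subset_outMidExits4` with the good event `AdjGoodP`
("by independence", `real_le_adjStep_at`, `real_not_adjGoodP_le_at`), the landing
`real_outMidExits4_le_at`, the outward extension `real_extFourAdjR_mul_le_outward_at` and the
initial estimate `pow_le_real_extFourAdjR_at`; the scheme runs on the clean event
`adjFourArmClean` (antitone in the outer radius), equal to `adjFourArmCyc` up to cleaning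
(`adjFourArmCyc_subset_adjFourArmClean`).

* `exists_adj_scheme_constants`, `arung_guards`, `adjFourArmCyc_subset_adjFourArmClean`,
  `adjFourArmClean_subset_outMidExits4_union`;
* `exists_real_adjFourArmCyc_le_mul_extFourAdjR_at` — the theorem.

Everything here is proved; no named facts are introduced.

## References

* P. Nolin, Near-critical percolation in two dimensions, *Electron. J. Probab.* 13 (2008), §4.4
  Thm. 11 (arXiv 0711.4948: Thm. 10, pp. 11–13), external extremities, σ = BBWW [Nolin2008].
* H. Kesten, Scaling relations for 2D-percolation, *Comm. Math. Phys.* 109 (1987), Lemma 2 [Kesten1987].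
-/

noncomputable section

open MeasureTheory Set

namespace Literature.Probability.Percolation

open LatticeModels

/-! ### Constants -/

/-- **The constants of the scheme**: `T, K, K_g ≥ 1` with
`12 (2 a^{T+1} + 2 T b^K + 3 b'^{K_g}) C₀² ≤ 1/2`. [folklore] -/
theorem exists_adj_scheme_constants {a b b' C₀ : ℝ} (ha0 : 0 ≤ a) (ha1 : a < 1) (hb0 : 0 ≤ b) (hb1 : b < 1) (hb0' : 0 ≤ b') (hb1' : b' < 1)
    (hC₀ : 1 ≤ C₀) :
    ∃ T K Kg : ℕ, 1 ≤ K ∧ 1 ≤ Kg ∧ 12 * (2 * a ^ (T + 1) + 2 * (T * b ^ K) + 3 * b' ^ Kg) * C₀ ^ 2 ≤ 1 / 2 := by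
  have hC2 : 0 < C₀ ^ 2 := by positivity
  set δ : ℝ := 1 / (168 * C₀ ^ 2) with hδ
  have hδ0 : 0 < δ := by positivity
  obtain ⟨T, hT⟩ := exists_pow_lt_of_lt_one hδ0 ha1
  have hδT : 0 < δ / (T + 1) := by positivity
  obtain ⟨K', hK'⟩ := exists_pow_lt_of_lt_one hδT hb1
  obtain ⟨Kg, hKg⟩ := exists_pow_lt_of_lt_one hδ0 hb1'
  refine ⟨T, K' + 1, Kg + 1, by omega, by omega, ?_⟩
  have h1 : a ^ (T + 1) ≤ δ := by
    calc a ^ (T + 1) ≤ a ^ T := pow_le_pow_of_le_one ha0 ha1.le (Nat.le_succ T)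
      _ ≤ δ := hT.le
  have h2 : (T : ℝ) * b ^ (K' + 1) ≤ δ := by
    have hb' : b ^ (K' + 1) ≤ b ^ K' := pow_le_pow_of_le_one hb0 hb1.le (Nat.le_succ K')
    have hT0 : (0 : ℝ) ≤ T := Nat.cast_nonneg T
    have hT1 : (0 : ℝ) < T + 1 := by positivity
    calc (T : ℝ) * b ^ (K' + 1) ≤ (T + 1) * b ^ K' := by nlinarith [pow_nonneg hb0 K', pow_nonneg hb0 (K' + 1)]
      _ ≤ (T + 1) * (δ / (T + 1)) := mul_le_mul_of_nonneg_left hK'.le hT1.le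
      _ = δ := by field_simp
  have h3 : b' ^ (Kg + 1) ≤ δ := by
    calc b' ^ (Kg + 1) ≤ b' ^ Kg := pow_le_pow_of_le_one hb0' hb1'.le (Nat.le_succ Kg)
      _ ≤ δ := hKg.le
  calc 12 * (2 * a ^ (T + 1) + 2 * (T * b ^ (K' + 1)) + 3 * b' ^ (Kg + 1)) * C₀ ^ 2 ≤ 12 * (2 * δ + 2 * δ + 3 * δ) * C₀ ^ 2 := by
        gcongr
    _ = 1 / 2 := by rw [hδ]; field_simp; ring

/-- **The guard arithmetic of the outer rung** (`D = 256 · 32^{K+K_g}`, `M ≥ 64 D`, `K, K_g ≥ 1`): with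
`k₀ = 4⌊M/(4D)⌋`, `μ = k₀ 32^K`, `R_g = 9 μ`, `R_g' = 16 · R_g 32^{K_g - 1}`: the scales are
`< M / 31`, the guard squares stay outside `Λ_M`, and the small facts used by the bricks. [folklore] -/
theorem arung_guards {K Kg D M n : ℕ} (hK : 1 ≤ K) (hKg : 1 ≤ Kg) (hD : D = 256 * 32 ^ (K + Kg)) (hM : 64 * D ≤ M) :
    let P := arung M n D K
    (∀ j < K, 31 * trapScale P.k₀ j < M) ∧ (∀ j < K, 32 * (trapScale P.k₀ j : ℤ) + 1 ≤ M) ∧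
    (∀ l < Kg, 16 * trapScale (9 * P.μ) l ≤ 16 * trapScale (9 * P.μ) (Kg - 1)) ∧ 16 * trapScale (9 * P.μ) (Kg - 1) < M ∧
    (∀ l < Kg, 8 * trapScale (9 * P.μ) l < M) ∧ (∀ l < Kg, 2 * trapScale (9 * P.μ) l + 1 ≤ M) ∧
    1 ≤ P.k₀ ∧ 1 ≤ 9 * P.μ ∧ 3 ≤ M ∧ 8 * trapScale P.k₀ (K - 1) + 1 ≤ 9 * P.μ ∧ P.R₀ + P.μ ≤ 9 * P.μ := by
  intro P
  have hX : 1 ≤ 32 ^ K := Nat.one_le_pow _ _ (by norm_num)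
  have hXg : 1 ≤ 32 ^ Kg := Nat.one_le_pow _ _ (by norm_num)
  have hDK : 256 * 32 ^ K ≤ D := by
    rw [hD, pow_add]; exact Nat.mul_le_mul_left _ (Nat.le_mul_of_pos_right _ hXg)
  obtain ⟨hk, hkMD, hkD, hμ256⟩ := arung_sizes (K := K) hDK hM
  have hk₀ : P.k₀ = 4 * (M / (4 * D)) := rfl
  have hμ : P.μ = trapScale (4 * (M / (4 * D))) K := rfl
  have hR₀ : P.R₀ = 8 * trapScale (4 * (M / (4 * D))) K := rfl
  set k₀ := 4 * (M / (4 * D)) with hk₀'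
  -- `μ 32^Kg ≤ M / 256`
  have hbig : 256 * (trapScale k₀ K * 32 ^ Kg) ≤ M := by
    unfold trapScale
    calc 256 * (k₀ * 32 ^ K * 32 ^ Kg) = k₀ * (256 * 32 ^ (K + Kg)) := by rw [pow_add]; ring
      _ = k₀ * D := by rw [hD]
      _ ≤ M := by rw [Nat.mul_comm]; exact hkD
  have hsc : ∀ j < K, 32 * trapScale k₀ j ≤ trapScale k₀ K := fun j hj => by
    calc 32 * trapScale k₀ j = trapScale k₀ (j + 1) := (trapScale_succ _ _).symm
      _ ≤ trapScale k₀ K := trapScale_mono _ hj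
  have hg : ∀ l < Kg, trapScale (9 * trapScale k₀ K) l ≤ trapScale (9 * trapScale k₀ K) (Kg - 1) := fun l hl => trapScale_mono _ (by omega)
  have hgtop : 16 * trapScale (9 * trapScale k₀ K) (Kg - 1) < M := by
    unfold trapScale at hbig ⊢
    have e : 32 ^ Kg = 32 ^ (Kg - 1) * 32 := by rw [← pow_succ, Nat.sub_add_cancel hKg]
    rw [e] at hbig
    have hμ1 : 1 ≤ k₀ * 32 ^ K := by nlinarith
    nlinarith
  refine ⟨fun j hj => ?_, fun j hj => ?_, fun l hl => Nat.mul_le_mul_left _ (hg l hl), hgtop, fun l hl => ?_, fun l hl => ?_, by omega, ?_, by omega,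
    ?_, ?_⟩
  · show 31 * trapScale k₀ j < M; have := hsc j hj; omega
  · show 32 * (trapScale k₀ j : ℤ) + 1 ≤ M; have := hsc j hj; omega
  · show 8 * trapScale (9 * trapScale k₀ K) l < M; have := hg l hl; omega
  · show 2 * trapScale (9 * trapScale k₀ K) l + 1 ≤ M; have := hg l hl; omega
  · show 1 ≤ 9 * trapScale k₀ K; have := one_le_trapScale (k₀ := k₀) (by omega) K; omega
  · show 8 * trapScale k₀ (K - 1) + 1 ≤ 9 * trapScale k₀ K
    have := trapScale_mono k₀ (show K - 1 ≤ K by omega); have := one_le_trapScale (k₀ := k₀) (by omega) K; omega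
  · show 8 * trapScale k₀ K + trapScale k₀ K ≤ 9 * trapScale k₀ K; omega

/-! ### Cleaning and the surgery inclusion -/

/-- **Cyclically adjacent arms contain clean ones with the same certificate** (`1 ≤ n`, `n + 2 ≤ N`). [cite: Nolin2008, §4.1 (arXiv 0711.4948, §4.1)] [cite: BollobasRiordan2006, Ch. 7 Lemma 5 p. 169] -/
theorem adjFourArmCyc_subset_adjFourArmClean {n N : ℕ} (hn : 1 ≤ n) (hnN : n + 2 ≤ N) : adjFourArmCyc n N ⊆ adjFourArmClean n N := by
  intro ω hω
  obtain ⟨x, y, W, hW, hdW, hsep⟩ := exists_clean_arms hn (by omega) hω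
  -- walks inside the clean sets
  have harms : ∀ j, ∃ w : triGraph.Walk (x j) (y j), w.IsPath ∧ ∀ v ∈ w.support, v ∈ W j := fun j => by
    obtain ⟨w, hw⟩ := (hW j).2.2.2.1.exists_walk
    exact ⟨w.bypass, w.bypass_isPath, fun v hv => hw v (w.support_bypass_subset_support hv)⟩
  choose w hwp hwW using harms
  -- the outer certificate from the inner one
  have key := hexSep_iff_of_four_paths hn hnN (fun j => (hW j).2.2.1) (fun j => (hW j).1) (fun j => (hW j).2.1) (fun j => (hW j).2.2.2.1)
    (fun j => (hW j).2.2.2.2.1) (fun j => (hW j).2.2.2.2.2.1) hdW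
  refine ⟨x, y, w, fun j => ⟨mem_triSphere_iff.2 (hW j).1, mem_triSphere_iff.2 (hW j).2.1, hwp j, fun v hv => ?_, fun v hv => (hW j).2.2.2.2.2.2 v (hwW j v hv)⟩,
    fun i j hij => ?_, fun h => hsep (key.1 h), fun j v hv hvn => (hW j).2.2.2.2.1 v (hwW j v hv) hvn,
    fun j v hv hvn => (hW j).2.2.2.2.2.1 v (hwW j v hv) hvn⟩
  · have h := mem_triAnn.1 ((hW j).2.2.1 (hwW j v hv))
    by_cases hvn : triNorm v ≤ n
    · exact Or.inr (mem_triSphere_iff.2 (le_antisymm hvn h.1))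
    · exact Or.inl ⟨Finset.mem_coe.2 (mem_triBall_iff.2 h.2), fun h' => hvn (mem_triBall_iff.1 (Finset.mem_coe.1 h'))⟩
  · show Disjoint (w i).support.toFinset (w j).support.toFinset
    rw [Finset.disjoint_left]
    intro v hv hv'
    exact Set.disjoint_left.1 (hdW hij) (hwW i v (List.mem_toFinset.1 hv)) (hwW j v (List.mem_toFinset.1 hv'))

/-- **The surgery step as an inclusion**: `adjFourArmClean n (2M) ⊆ OutMidExits4 P ∪ ({¬ AdjGoodP} ∩ adjFourArmClean n M)`
for the outer rung `P = arung M n D K` (`K, K_g ≥ 1`, `D = 256 · 32^{K+K_g}`, `M ≥ 64 D`, `1 ≤ n`, `n + 2 ≤ M`). [cite: Nolin2008, §4.4 (arXiv 0711.4948: proof of Thm. 10, p. 12), σ = BBWW] -/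
theorem adjFourArmClean_subset_outMidExits4_union {K Kg D M n T : ℕ} (hK : 1 ≤ K) (hKg : 1 ≤ Kg) (hD : D = 256 * 32 ^ (K + Kg))
    (hM : 64 * D ≤ M) (hn : 1 ≤ n) (hnM : n + 2 ≤ M) :
    adjFourArmClean n (2 * M) ⊆ OutMidExits4 (arung M n D K) ∪
      ({ω | ¬ AdjGoodP M (arung M n D K).k₀ K T T (9 * (arung M n D K).μ) Kg ω} ∩ adjFourArmClean n M) := by
  intro ω hω
  have hXg : 1 ≤ 32 ^ Kg := Nat.one_le_pow _ _ (by norm_num)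
  have hDK : 256 * 32 ^ K ≤ D := by rw [hD, pow_add]; exact Nat.mul_le_mul_left _ (Nat.le_mul_of_pos_right _ hXg)
  obtain ⟨-, -, -, -, -, hRgM, -, -, -, hRg8, hRgμ⟩ := arung_guards (n := n) hK hKg hD hM
  have hV := arung_validA (n := n) hK hDK hM (by omega)
  by_cases hg : AdjGoodP M (arung M n D K).k₀ K T T (9 * (arung M n D K).μ) Kg ω
  · left
    have hgood : AdjGood (arung M n D K) T T (9 * (arung M n D K).μ) Kg ω := adjGood_of_adjGoodP (P := arung M n D K) hRg8 hRgM hg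
    exact adjFourArmCyc_subset_outMidExits4 hV hn hRgμ hRgM ⟨adjFourArmClean_subset_adjFourArmCyc _ _ hω, hgood⟩
  · exact Or.inr ⟨hg, adjFourArmClean_anti hn hnM (by omega) hω⟩

/-! ### The external half at `p` -/

/-- **The external half of the four-arm separation theorem for the adjacent arrangement, at `p`**
(Nolin 2008, Thm. 11 for `j = 4`, `σ = BBWW`, external extremities, "uniformly in `p`"): for
constants `c_F ∈ (0, 1]` (frames) and `c ∈ (0, 1]` (RSW at aspect ratio `1024`) there is a number of
scales `K`, and then for every `c_L ∈ (0, 1]` (RSW at aspect ratio `256 · 32^K`, used only by the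
landing) there are `C > 0` and `n₀` such that at every parameter `p` at which the three inputs hold at
`p` and at `1 - p` for boxes of height `≤ Ncap`,
`P_p(adjFourArmCyc n N) ≤ C · P_p(extFourAdjR n N)` for all `n ≥ n₀`, `2n ≤ N ≤ Ncap`. [cite: Nolin2008, §4.4 Thm. 11 (arXiv 0711.4948: Thm. 10, pp. 11–13), external extremities, σ = BBWW; Kesten1987, Lemma 2] -/
theorem exists_real_adjFourArmCyc_le_mul_extFourAdjR_at {cF c : ℝ} (hcF : 0 < cF) (hcF1 : cF ≤ 1) (hc : 0 < c) (hc1 : c ≤ 1) :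
    ∃ K : ℕ, ∀ cL : ℝ, 0 < cL → cL ≤ 1 → ∃ C : ℝ, 0 < C ∧ ∃ n₀ : ℕ, ∀ (p : unitInterval) (Ncap : ℕ),
      (∀ q : unitInterval, (q = p ∨ q = unitInterval.symm p) →
        ∀ (z : Site 2) (k : ℕ), 1 ≤ k → k ≤ Ncap → cF ≤ (triSitePercolation q).real (triFrameAt z k)) →
      (∀ q : unitInterval, (q = p ∨ q = unitInterval.symm p) →
        ∀ k : ℕ, 1 ≤ ⌊((1024 : ℕ) : ℝ) * k⌋₊ → k ≤ Ncap → c ≤ triLRCrossingProb q ⌊((1024 : ℕ) : ℝ) * k⌋₊ k) →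
      (∀ q : unitInterval, (q = p ∨ q = unitInterval.symm p) →
        ∀ k : ℕ, 1 ≤ ⌊((256 * 32 ^ K : ℕ) : ℝ) * k⌋₊ → k ≤ Ncap → cL ≤ triLRCrossingProb q ⌊((256 * 32 ^ K : ℕ) : ℝ) * k⌋₊ k) →
      ∀ n N : ℕ, n₀ ≤ n → 2 * n ≤ N → N ≤ Ncap →
        (triSitePercolation p).real (adjFourArmCyc n N) ≤ C * (triSitePercolation p).real (extFourAdjR n N) := by
  -- the constants
  set a : ℝ := 1 - c with ha
  set b : ℝ := 1 - cF ^ 2 * c ^ 4 * c ^ 4 with hb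
  set b' : ℝ := 1 - cF ^ 2 with hb'
  have ha0 : 0 ≤ a := by rw [ha]; linarith
  have ha1 : a < 1 := by rw [ha]; linarith
  have hcc : 0 < cF ^ 2 * c ^ 4 * c ^ 4 := by positivity
  have hcc1 : cF ^ 2 * c ^ 4 * c ^ 4 ≤ 1 :=
    mul_le_one₀ (mul_le_one₀ (pow_le_one₀ hcF.le hcF1) (by positivity) (pow_le_one₀ hc.le hc1)) (by positivity) (pow_le_one₀ hc.le hc1)
  have hb0 : 0 ≤ b := by rw [hb]; linarith
  have hb1 : b < 1 := by rw [hb]; linarith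
  have hb0' : 0 ≤ b' := by rw [hb']; linarith [pow_le_one₀ hcF.le hcF1 (n := 2)]
  have hb1' : b' < 1 := by rw [hb']; linarith [pow_pos hcF 2]
  have hq95 : 0 < (c ^ 95) ^ 4 := by positivity
  set C₀ : ℝ := 1 / (c ^ 95) ^ 4 with hC₀def
  have hC₀ : 1 ≤ C₀ := by
    rw [hC₀def, le_div_iff₀ hq95, one_mul]
    calc (c ^ 95) ^ 4 ≤ (1 : ℝ) ^ 4 := by gcongr; exact pow_le_one₀ hc.le hc1
      _ = 1 := one_pow 4
  have hC₀0 : 0 < C₀ := lt_of_lt_of_le one_pos hC₀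
  obtain ⟨T, K, Kg, hK1, hKg1, hsmall⟩ := exists_adj_scheme_constants ha0 ha1 hb0 hb1 hb0' hb1' hC₀
  refine ⟨K, fun cL hcL hcL1 => ?_⟩
  set ε : ℝ := 12 * (2 * a ^ (T + 1) + 2 * (T * b ^ K) + 3 * b' ^ Kg) with hε
  have hε0 : 0 ≤ ε := by positivity
  have hεC : ε * C₀ ^ 2 ≤ 1 / 2 := by rw [hε]; exact hsmall
  set D : ℕ := 256 * 32 ^ (K + Kg) with hD
  have hXg : 1 ≤ 32 ^ Kg := Nat.one_le_pow _ _ (by norm_num)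
  have hDK : 256 * 32 ^ K ≤ D := by
    rw [hD, pow_add]; exact Nat.mul_le_mul_left _ (Nat.le_mul_of_pos_right _ hXg)
  have hD1 : 1 ≤ D := le_trans (Nat.one_le_pow K 32 (by norm_num)) (le_trans (Nat.le_mul_of_pos_left _ (by norm_num)) hDK)
  set ci : ℝ := (c ^ 5) ^ 4 with hci
  have hci0 : 0 < ci := by positivity
  set Bg : ℕ := 156 * D + 44 with hBg
  obtain ⟨Nsl, hNsl⟩ : ∃ Nsl : ℕ, Nsl = ((156 * D + 45) ^ 4) ^ 8 := ⟨_, rfl⟩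
  have hslots : ∀ M' n', 64 * D ≤ M' → (∏ q : Fin 8, ∏ e : Fin 4, aslotBound (arung M' n' D K) q e : ℕ) ≤ Nsl := fun M' n' hM' => by
    rw [hNsl]; exact arung_slots_le (n := n') hDK hM'
  clear hNsl
  set qL : ℝ := (cL ^ (Bg + 3)) ^ 4 with hqL
  have hqL0 : 0 < qL := by positivity
  set C₁ : ℝ := Nsl / qL with hC₁
  have hC₁0 : 0 ≤ C₁ := by positivity
  set Cs : ℝ := 2 * C₁ + 1 / ci with hCs
  have hCs0 : 0 < Cs := by positivity
  refine ⟨Cs * C₀ + 1 / ci, by positivity, 32 * D + 1100, fun p Ncap hF hrsw hrswL n N hn hN hcapN => ?_⟩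
  have hn1100 : 1100 ≤ n := le_trans (Nat.le_add_left _ _) hn
  have hnD : 32 * D ≤ n := le_trans (Nat.le_add_right _ _) hn
  have hn1 : 1 ≤ n := by omega
  set μ := triSitePercolation p with hμ
  have hP1 : ∀ s : Set (SiteConfig (Site 2)), μ.real s ≤ 1 := fun s => measureReal_le_one
  have hP0 : ∀ s : Set (SiteConfig (Site 2)), 0 ≤ μ.real s := fun s => measureReal_nonneg
  have hρ1024 : (64 : ℕ) ≤ 1024 := by norm_num
  have hinit : ∀ N', 2 * n ≤ N' → N' ≤ 10 * n → N' ≤ Ncap → ci ≤ μ.real (extFourAdjR n N') := fun N' h1 h2 h3 =>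
    pow_le_real_extFourAdjR_at p hrsw le_rfl hc.le hn1100 h1 h2 h3
  have hcycle : ∀ R, n + 2 ≤ R → μ.real (adjFourArmCyc n R) ≤ μ.real (adjFourArmClean n R) := fun R hR =>
    measureReal_mono (adjFourArmCyc_subset_adjFourArmClean hn1 hR) (measure_ne_top _ _)
  -- small `N`: the initial estimate alone
  by_cases hsmallN : N < 8 * n
  · have h1 : ci ≤ μ.real (extFourAdjR n N) := hinit N hN (by omega) hcapN
    have h2 : 1 ≤ 1 / ci * μ.real (extFourAdjR n N) := by
      rw [one_div, inv_mul_eq_div, le_div_iff₀ hci0]; linarith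
    calc μ.real (adjFourArmCyc n N) ≤ 1 := hP1 _
      _ ≤ 1 / ci * μ.real (extFourAdjR n N) := h2
      _ ≤ (Cs * C₀ + 1 / ci) * μ.real (extFourAdjR n N) := by
          have := hP0 (extFourAdjR n N); have : 0 ≤ Cs * C₀ := by positivity
          nlinarith
  push Not at hsmallN
  -- the ladder `ρ K' = 2n · 2^K'` and its top `L ≥ 1` with `2 ρ L ≤ N < 4 ρ L`
  set ρ : ℕ → ℕ := fun K' => 2 * n * 2 ^ K' with hρ
  have hρsucc : ∀ K', ρ (K' + 1) = 2 * ρ K' := fun K' => by simp only [hρ, pow_succ]; ring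
  have hρn : ∀ K', 2 * n ≤ ρ K' := fun K' => by
    simp only [hρ]; exact Nat.le_mul_of_pos_right _ (Nat.one_le_two_pow)
  have hρmono : ∀ K', ρ K' ≤ ρ (K' + 1) := fun K' => by rw [hρsucc]; omega
  have hex : ∃ j, N < 2 * ρ (j + 1) := by
    refine ⟨N, ?_⟩
    simp only [hρ]
    have h2 : N + 1 < 2 ^ (N + 1) := Nat.lt_two_pow_self
    have h3 : 1 ≤ 2 * n := by omega
    calc N < 2 ^ (N + 1) := by omega
      _ ≤ 2 * n * 2 ^ (N + 1) := Nat.le_mul_of_pos_left _ h3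
      _ ≤ 2 * (2 * n * 2 ^ (N + 1)) := Nat.le_mul_of_pos_left _ (by norm_num)
  classical
  set L := Nat.find hex with hL
  have hLspec : N < 2 * ρ (L + 1) := Nat.find_spec hex
  have hL1 : 1 ≤ L := by
    by_contra h
    have hL0 : L = 0 := by omega
    rw [hL0, zero_add] at hLspec
    simp only [hρ, pow_one] at hLspec
    omega
  have hLle : 2 * ρ L ≤ N := by
    have := Nat.find_min hex (show L - 1 < L by omega)
    rw [show L - 1 + 1 = L by omega] at this
    omega
  have hρLN : ρ L ≤ N := by omega
  have hNρ : N ≤ 32 * ρ L := by rw [hρsucc] at hLspec; omega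
  have hρL_le : ∀ K', K' ≤ L → ρ K' ≤ ρ L := fun K' hK' => by
    simp only [hρ]; exact Nat.mul_le_mul_left _ (Nat.pow_le_pow_right (by norm_num) hK')
  -- the frame, RSW and ring inputs at the scales of the ladder
  have hFM : ∀ M, M ≤ N → ∀ q : unitInterval, (q = p ∨ q = unitInterval.symm p) →
      ∀ (z : Site 2) (k : ℕ), 1 ≤ k → k < M → cF ≤ (triSitePercolation q).real (triFrameAt z k) :=
    fun M hM q hq z k hk hkM => hF q hq z k hk (by omega)
  have hfl : ∀ k : ℕ, ⌊((1024 : ℕ) : ℝ) * (k : ℕ)⌋₊ = 1024 * k := fun k => by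
    have : ((1024 : ℕ) : ℝ) * (k : ℕ) = ((1024 * k : ℕ) : ℝ) := by push_cast; ring
    rw [this, Nat.floor_natCast]
  have hc4 : ∀ M, 2 ≤ M → M ≤ N → ∀ q : unitInterval, (q = p ∨ q = unitInterval.symm p) →
      c ≤ triLRCrossingProb q (4 * (M - 1)) (M - 1) := fun M hM hMN q hq => by
    have h := hrsw q hq (M - 1) (by rw [hfl]; omega) (by omega)
    rw [hfl] at h
    exact h.trans (triLRCrossingProb_anti_width q (by omega) _)
  have hσq : ∀ q : unitInterval, (q = p ∨ q = unitInterval.symm p) → (unitInterval.symm q = p ∨ unitInterval.symm q = unitInterval.symm p) := by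
    rintro q (rfl | rfl)
    · exact Or.inr rfl
    · exact Or.inl (unitInterval.symm_symm p)
  have hEr : ∀ M, M ≤ N → ∀ q : unitInterval, (q = p ∨ q = unitInterval.symm p) →
      ∀ (z : Site 2) (k : ℕ), 1 ≤ k → 32 * k < M → c ^ 4 ≤ (triSitePercolation q).real (compl ⁻¹' triRingAt z k) := by
    intro M hMN q hq z k hk hkM
    rw [real_compl_preimage_triRingAt]
    refine le_real_triRingAt_of_rsw _ hc.le z k ?_
    have h := hrsw _ (hσq q hq) (14 * k) (by rw [hfl]; omega) (by omega)
    rw [hfl] at h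
    exact h.trans (triLRCrossingProb_anti_width _ (by omega) _)
  have hIr : ∀ M, M ≤ N → ∀ q : unitInterval, (q = p ∨ q = unitInterval.symm p) →
      ∀ (z : Site 2) (k : ℕ), 1 ≤ k → 32 * k < M → c ^ 4 ≤ (triSitePercolation q).real (compl ⁻¹' triInnerRingAt z k) := by
    intro M hMN q hq z k hk hkM
    rw [real_compl_preimage_triInnerRingAt]
    refine le_real_triInnerRingAt_of_rsw _ hc.le z k ?_
    have h := hrsw _ (hσq q hq) (4 * k) (by rw [hfl]; omega) (by omega)
    rw [hfl] at h
    exact h.trans (triLRCrossingProb_anti_width _ (by omega) _)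
  have hc40 : 0 ≤ c ^ 4 := by positivity
  have hc41 : c ^ 4 ≤ 1 := pow_le_one₀ hc.le hc1
  -- the three sequences
  set f : ℕ → ℝ := fun K' => μ.real (adjFourArmClean n (ρ K')) with hf
  set g : ℕ → ℝ := fun K' => μ.real (OutMidExits4 (arung (ρ (K' - 1)) n D K)) with hg
  set h : ℕ → ℝ := fun K' => μ.real (extFourAdjR n (ρ K')) with hh
  have key := le_mul_of_separationScheme_upto (f := f) (g := g) (h := h) (k := 0) (L := L) hε0 hC₀ hC₁0 hci0 hεC
    (fun K' => hP1 _) (fun K' => hP0 _) (by omega)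
    (fun K' _ _ => measureReal_mono (adjFourArmClean_anti hn1 (by have := hρn K'; omega) (hρmono K')) (measure_ne_top _ _))
    (fun K' _ hK'L => by
      -- the surgery step at half-radius `M = ρ K'`, `2M = ρ (K'+1)`
      have hM : 64 * D ≤ ρ K' := by have := hρn K'; omega
      obtain ⟨gKM31, gKM, gRg, gRgM, gKg8, gKg2, gk₀, gRg1, gM3, -, -⟩ := arung_guards (n := n) hK1 hKg1 hD hM
      have hnM : n + 2 ≤ ρ K' := by have := hρn K'; omega
      have hMN : ρ K' ≤ N := (hρL_le K' (by omega)).trans hρLN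
      have dA : DeterminedBy (adjFourArmClean n (ρ K')) ↑(triBall (ρ K')) :=
        (determinedBy_adjFourArmClean (r := n) (R := ρ K') (by omega)).mono fun v hv => by
          rw [Finset.mem_coe] at hv ⊢; exact (Finset.mem_filter.1 hv).1
      have step := real_le_adjStep_at p (T := T) (T' := T) (by omega) gKM31 gRg gRgM dA
        (adjFourArmClean_subset_outMidExits4_union (T := T) hK1 hKg1 hD hM hn1 hnM)
      have bad := real_not_adjGoodP_le_at p (cE := c ^ 4) (cI := c ^ 4) hcF hcF1 hc40 hc41 hc40 hc41 gM3 (hFM (ρ K') hMN)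
        (hc4 (ρ K') (by omega) hMN) (hEr (ρ K') hMN) (hIr (ρ K') hMN) (T := T) (T' := T) (Kg := Kg) gk₀ gKM gRg1 gKg8
      have hbad' : μ.real {ω | ¬ AdjGoodP (ρ K') (arung (ρ K') n D K).k₀ K T T (9 * (arung (ρ K') n D K).μ) Kg ω} ≤ ε := by
        refine bad.trans (le_of_eq ?_)
        rw [hε, ha, hb, hb']; ring
      have hgK : μ.real (OutMidExits4 (arung (ρ K') n D K)) = g (K' + 1) := by
        simp only [hg, Nat.add_sub_cancel]
      have hfK : 0 ≤ f K' := hP0 _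
      have hbf := mul_le_mul_of_nonneg_right hbad' hfK
      show μ.real (adjFourArmClean n (ρ (K' + 1))) ≤ g (K' + 1) + ε * μ.real (adjFourArmClean n (ρ K'))
      rw [hρsucc, ← hgK]
      linarith [step, hbf])
    (fun K' hK' hK'L => by
      -- the landing inequality at half-radius `ρ (K'-1)`: `4 ρ (K'-1) = ρ (K'+1)`
      have hM : 64 * D ≤ ρ (K' - 1) := by have := hρn (K' - 1); omega
      have hnM : n ≤ ρ (K' - 1) := by have := hρn (K' - 1); omega
      have hV := arung_validA (n := n) hK1 hDK hM hnM
      have h4 : 4 * ρ (K' - 1) = ρ (K' + 1) := by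
        rw [show K' + 1 = (K' - 1) + 1 + 1 by omega, hρsucc, hρsucc]; ring
      have hMN : ρ (K' + 1) ≤ N := (hρL_le (K' + 1) hK'L).trans hρLN
      have hX : 1 ≤ 32 ^ K := Nat.one_le_pow _ _ (by norm_num)
      have hcap : (arung (ρ (K' - 1)) n D K).N' / 16 ≤ Ncap := by
        show 4 * ρ (K' - 1) / 16 ≤ Ncap; omega
      have hland := real_outMidExits4_le_at hV p hrswL (ρ := 256 * 32 ^ K) (by omega) hcL.le
        (arung_aspect7 (n := n) hDK hM) hcap (arung_GrA7_le (n := n) hDK hM)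
      have hsl : ((∏ q : Fin 8, ∏ e : Fin 4, aslotBound (arung (ρ (K' - 1)) n D K) q e : ℕ) : ℝ) ≤ (Nsl : ℝ) := by
        exact_mod_cast hslots (ρ (K' - 1)) n hM
      show μ.real (OutMidExits4 (arung (ρ (K' - 1)) n D K)) ≤ C₁ * μ.real (extFourAdjR n (ρ (K' + 1)))
      rw [← h4, hC₁, div_mul_eq_mul_div, le_div_iff₀ hqL0]
      calc μ.real (OutMidExits4 (arung (ρ (K' - 1)) n D K)) * qL
          ≤ (∏ q : Fin 8, ∏ e : Fin 4, aslotBound (arung (ρ (K' - 1)) n D K) q e : ℕ) * μ.real (extFourAdjR n (4 * ρ (K' - 1))) := hland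
        _ ≤ (Nsl : ℝ) * μ.real (extFourAdjR n (4 * ρ (K' - 1))) := mul_le_mul_of_nonneg_right hsl (hP0 _))
    (fun K' hK' hK'L => by
      -- the outward extension from `ρ K'` to `ρ (K'+1) = 2 ρ K'`
      have h2200 : 2200 ≤ ρ K' := by have := hρn K'; omega
      have hMN : ρ (K' + 1) ≤ N := (hρL_le (K' + 1) hK'L).trans hρLN
      have h1 := real_extFourAdjR_mul_le_outward_at p hrsw hρ1024 hc.le h2200 (hρn K') (by rw [hρsucc]) (by rw [hρsucc]; omega)
        (hMN.trans hcapN)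
      show μ.real (extFourAdjR n (ρ K')) ≤ C₀ * μ.real (extFourAdjR n (ρ (K' + 1)))
      rw [hC₀def, one_div, ← div_eq_inv_mul, le_div_iff₀ hq95]
      exact h1)
    (by
      -- the initial estimate at `ρ 1 = 4n`
      show ci ≤ μ.real (extFourAdjR n (ρ (0 + 1)))
      have hρ1 : ρ (0 + 1) = 4 * n := by simp only [hρ, zero_add, pow_one]; ring
      rw [hρ1]
      have h41 : ρ 1 ≤ N := (hρL_le 1 hL1).trans hρLN
      have hρ1' : ρ 1 = 4 * n := by simp only [hρ, pow_one]; ring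
      exact hinit (4 * n) (by omega) (by omega) (by rw [← hρ1']; exact h41.trans hcapN))
    L hL1 le_rfl
  simp only [hf, hh] at key
  -- from `ρ L` to `N`
  have h2200 : 2200 ≤ ρ L := by have := hρn L; omega
  have e1 : μ.real (adjFourArmCyc n N) ≤ μ.real (adjFourArmClean n (ρ L)) :=
    (hcycle N (by omega)).trans (measureReal_mono (adjFourArmClean_anti hn1 (by have := hρn L; omega) hρLN) (measure_ne_top _ _))
  have e2 := real_extFourAdjR_mul_le_outward_at p hrsw hρ1024 hc.le h2200 (hρn L) hLle hNρ hcapN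
  have e2' : μ.real (extFourAdjR n (ρ L)) ≤ C₀ * μ.real (extFourAdjR n N) := by
    rw [hC₀def, one_div, ← div_eq_inv_mul, le_div_iff₀ hq95]; exact e2
  have e3 : 0 ≤ μ.real (extFourAdjR n N) := hP0 _
  calc μ.real (adjFourArmCyc n N) ≤ Cs * μ.real (extFourAdjR n (ρ L)) := e1.trans key
    _ ≤ Cs * (C₀ * μ.real (extFourAdjR n N)) := mul_le_mul_of_nonneg_left e2' hCs0.le
    _ ≤ (Cs * C₀ + 1 / ci) * μ.real (extFourAdjR n N) := by
        have : 0 ≤ 1 / ci * μ.real (extFourAdjR n N) := by positivity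
        nlinarith

end Literature.Probability.Percolation
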